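import Mathlib
import HarnessLib
import Summits.HubbardSuperconductivity.HubbardSuperconductivity.Theorems.KLProgrammeKLRegimeSectorSliceCharSum
import Summits.HubbardSuperconductivity.HubbardSuperconductivity.Theorems.KLProgrammeKLRegimeSliceSymbolTorusNbhd

/-!
# Route `KLProgramme` — engine support (route (L2), ADDITIVE weight): the `ℓ¹` norm of ONE sector-pair character sum of the sectorised zero-seed
# counterterm slice covariance from MULTIPLIER DATA ALONE — the propagator side fully discharged

Cell `gate-hubbard-kl`, seat hubbard-kl-k3c2-p3 (row «sector-counting import (DR2000 L11/L12) for the leg-dress bar»), for the ENGINE child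
(gen 4: stmt-HubbardSuperconductivity-19855 `KLRegimeEngineV12`, `stub_engine_step_norms`; gen 3: 19823).  The propagator constant `α_n` of
`hubbardSectorKernelNorm_effAction_le_of_sectorNorm` is `8·Σ_{ω′} T(ω,ω′)` (`KLProgrammeKLRegimeSectorSliceRows`), `T(ω,ω′)` the `ℓ¹` norm of the
character sum with symbol `G_{ωω′}(q) = (βL²)⁻²·M_{ωω′}(q)·Ψ̂(q)`, `M_{ωω′} = F_ω F_{ω′}` sampled on `(ℤ/2M)¹ × (ℤ/L)²`, `Ψ̂` the slice profile through the
frame band.  This file proves the per-pair bound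

  **`slicePair_charSum_l1_le`**: `T(ω,ω′) ≤ √(2048(1/s₀+1)[4(2√2/(s₂|v|)+2)(2√2/(s₃|v|)+2) + 16(1/s₁+1)²/(1+s₁R₀)]) · √(16·2M·L²·N_s) · (βL²)⁻²·4βL²/Λ`

from: (frame) `‖De_K‖ ≤ K₁`, `‖D²e_K‖ ≤ K₂` (`FrameOK` (i): `7, 7`); (cutoff) `|χ₂′| ≤ B₁`, `|χ₂″| ≤ B₂`; (scales) `0 < Λ ≤ Λ′ < π(2M−3)/β`;
(MULTIPLIER DATA, p4 lineage (b₂)/(b₃)/(d-geom)) `‖M‖ ≤ 1`, `#{M ≠ 0} ≤ N_s`, pointwise `‖Δ_wM‖ ≤ a₁(w)`, `‖Δ_w²M‖ ≤ a₂(w)` in the five directions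
`w ∈ {(1,0), (0,e₁), (0,e₂), (0,v⊥), (0,v)}`, the tangential datum `M q ≠ 0 ⇒ |De_K(c(q₂))·(2π/L)v| ≤ τ`; and (RATES) `s₀,…,s₃ > 0` with the five
inequalities «Leibniz bound ≤ A₀(4/(s_wP_w))²», `A₀ = (βL²)⁻²·4βL²/Λ`, whose left sides are EXPLICIT in the data (the propagator factors are
Literature's `(16B₁+16)(βL²)/Λ²`, `(32B₂+144B₁+128)(βL²)/Λ³` times `(2π/β)ᵏ` in time, resp. `(|De_K·w| + jK₂‖w‖²)`-polynomials in space).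
Everything is proved; no definitions, no named facts. [folklore]

References: G. Benfatto, A. Giuliani, V. Mastropietro, Ann. Henri Poincaré 7 (2006) 809–898, §2.8 (2.81), Lemma 2.2 and footnote ¹; M. Disertori,
V. Rivasseau, Comm. Math. Phys. 215 (2000) 251–290, §IV.2 Lemma 4, App. A Lemma 12.
-/

noncomputable section

namespace Summit.HubbardSuperconductivity.HubbardSuperconductivity.Theorems.TorusFourierL2

set_option linter.dupNamespace false -- summit = problem name (single-conjunct summit), D-0017

open Finset Complex Literature.MathematicalPhysics.QuantumLattice Literature.Probability.LatticeModels
open Summit.HubbardSuperconductivity.HubbardSuperconductivity.Theorems.DispersionFlow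
open scoped Real

section Pair

variable {L M : ℕ} [NeZero L] [NeZero M]

/-- `|De_K(x)·w| ≤ K₁‖w‖` from `‖De_K‖ ≤ K₁` (the trivial, isotropic tangential datum). [folklore] -/
theorem abs_fderiv_apply_le_of_norm_le {μ : ℝ} {K : TrigPolyC4v} {K₁ : ℝ} (hK₁ : ∀ p, ‖fderiv ℝ (frameLevel μ K) p‖ ≤ K₁)
    (x w : EuclideanSpace ℝ (Fin 2)) : |fderiv ℝ (frameLevel μ K) x w| ≤ K₁ * ‖w‖ := by
  rw [← Real.norm_eq_abs]
  exact (ContinuousLinearMap.le_opNorm _ _).trans (mul_le_mul_of_nonneg_right (hK₁ x) (norm_nonneg _))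

/-- **The per-pair `ℓ¹` bound from multiplier data.**  See the module docstring for the list of data; the five rate inequalities `hr₀ … hr₃` are
the only arithmetic left to the instance. [cite: BenfattoGiulianiMastropietro2006, §2.8 (2.81)] -/
theorem slicePair_charSum_l1_le {β μ Λ Λ' : ℝ} {K : TrigPolyC4v} (hβ : 0 < β) (hΛ : 0 < Λ) (hΛΛ' : Λ ≤ Λ')
    (hM : Λ' < π * (2 * M - 3) / β)
    {K₁ K₂ : ℝ} (hK₁ : ∀ p, ‖fderiv ℝ (frameLevel μ K) p‖ ≤ K₁) (hK₂ : ∀ p, ‖iteratedFDeriv ℝ 2 (frameLevel μ K) p‖ ≤ K₂)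
    {B₁ B₂ : ℝ} (hB₁ : ∀ x, |deriv salmhoferCutoff x| ≤ B₁) (hB₂ : ∀ x, |deriv (deriv salmhoferCutoff) x| ≤ B₂)
    -- multiplier data
    (Mf : TorusSite 1 (2 * M) × TorusSite 2 L → ℂ) (hM0 : ∀ q, ‖Mf q‖ ≤ 1) {Ns : ℕ} (hsupp : (univ.filter fun q => Mf q ≠ 0).card ≤ Ns)
    (v : Fin 2 → ℤ) (hv : v ≠ 0) {R₀ : ℕ} (hR₀ : 2 * (|v 0| + |v 1|) * (R₀ : ℤ) < L)
    {at₁ at₂ : ℝ} (hat₁ : 0 ≤ at₁) (hat₂ : 0 ≤ at₂)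
    (hMt₁ : ∀ q, ‖fwdDiff ((fun _ : Fin 1 => (1 : ZMod (2 * M))), (0 : TorusSite 2 L)) Mf q‖ ≤ at₁)
    (hMt₂ : ∀ q, ‖(fwdDiff ((fun _ : Fin 1 => (1 : ZMod (2 * M))), (0 : TorusSite 2 L)))^[2] Mf q‖ ≤ at₂)
    (ae₁ ae₂ : Fin 2 → ℝ) (hae₁ : ∀ i, 0 ≤ ae₁ i) (hae₂ : ∀ i, 0 ≤ ae₂ i)
    (hMe₁ : ∀ q (i : Fin 2), ‖fwdDiff ((0 : TorusSite 1 (2 * M)), (Pi.single i (1 : ZMod L) : TorusSite 2 L)) Mf q‖ ≤ ae₁ i)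
    (hMe₂ : ∀ q (i : Fin 2), ‖(fwdDiff ((0 : TorusSite 1 (2 * M)), (Pi.single i (1 : ZMod L) : TorusSite 2 L)))^[2] Mf q‖ ≤ ae₂ i)
    {an₁ an₂ : ℝ} (han₁ : 0 ≤ an₁) (han₂ : 0 ≤ an₂)
    (hMn₁ : ∀ q, ‖fwdDiff ((0 : TorusSite 1 (2 * M)), (fun j => ((![-v 1, v 0] j : ℤ) : ZMod L))) Mf q‖ ≤ an₁)
    (hMn₂ : ∀ q, ‖(fwdDiff ((0 : TorusSite 1 (2 * M)), (fun j => ((![-v 1, v 0] j : ℤ) : ZMod L))))^[2] Mf q‖ ≤ an₂)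
    {av₁ av₂ : ℝ} (hav₁ : 0 ≤ av₁) (hav₂ : 0 ≤ av₂)
    (hMv₁ : ∀ q, ‖fwdDiff ((0 : TorusSite 1 (2 * M)), (fun j => ((v j : ℤ) : ZMod L))) Mf q‖ ≤ av₁)
    (hMv₂ : ∀ q, ‖(fwdDiff ((0 : TorusSite 1 (2 * M)), (fun j => ((v j : ℤ) : ZMod L))))^[2] Mf q‖ ≤ av₂)
    {τ : ℝ} (hτ0 : 0 ≤ τ)
    (hτ : ∀ q, Mf q ≠ 0 → |fderiv ℝ (frameLevel μ K) (WithLp.toLp 2 (torusCentredMomentum L q.2))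
      (WithLp.toLp 2 (fun i => 2 * π / L * (v i : ℝ)))| ≤ τ)
    -- rates and the five inequalities (`c = βL²`, `w_r = toLp ((2π/L)·r)`)
    {s₀ s₁ s₂ s₃ : ℝ} (hs₀ : 0 < s₀) (hs₁ : 0 < s₁) (hs₂ : 0 < s₂) (hs₃ : 0 < s₃)
    (hr₀ : (1 / (β * (L : ℝ) ^ 2)) ^ 2 *
        (1 * ((2 * π / β) ^ 2 * ((32 * B₂ + 144 * B₁ + 128) * (β * (L : ℝ) ^ 2) / Λ ^ 3)) +
          2 * (at₁ * ((2 * π / β) * ((16 * B₁ + 16) * (β * (L : ℝ) ^ 2) / Λ ^ 2))) +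
          at₂ * (4 * (β * (L : ℝ) ^ 2) / Λ)) ≤
      (1 / (β * (L : ℝ) ^ 2)) ^ 2 * (4 * (β * (L : ℝ) ^ 2) / Λ) * (4 / (s₀ * (2 * M : ℕ))) ^ 2)
    (hr₁ : ∀ i : Fin 2, (1 / (β * (L : ℝ) ^ 2)) ^ 2 *
        (1 * ((32 * B₂ + 144 * B₁ + 128) * (β * (L : ℝ) ^ 2) / Λ ^ 3 *
              (K₁ * ‖(WithLp.toLp 2 (fun j => 2 * π / L * ((Pi.single i (1 : ℤ) : Fin 2 → ℤ) j : ℝ)) : EuclideanSpace ℝ (Fin 2))‖ +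
                4 * (K₂ * ‖(WithLp.toLp 2 (fun j => 2 * π / L * ((Pi.single i (1 : ℤ) : Fin 2 → ℤ) j : ℝ)) :
                  EuclideanSpace ℝ (Fin 2))‖ ^ 2)) ^ 2 +
            (16 * B₁ + 16) * (β * (L : ℝ) ^ 2) / Λ ^ 2 *
              (K₂ * ‖(WithLp.toLp 2 (fun j => 2 * π / L * ((Pi.single i (1 : ℤ) : Fin 2 → ℤ) j : ℝ)) : EuclideanSpace ℝ (Fin 2))‖ ^ 2)) +
          2 * (ae₁ i * ((16 * B₁ + 16) * (β * (L : ℝ) ^ 2) / Λ ^ 2 *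
              (K₁ * ‖(WithLp.toLp 2 (fun j => 2 * π / L * ((Pi.single i (1 : ℤ) : Fin 2 → ℤ) j : ℝ)) : EuclideanSpace ℝ (Fin 2))‖ +
                3 * (K₂ * ‖(WithLp.toLp 2 (fun j => 2 * π / L * ((Pi.single i (1 : ℤ) : Fin 2 → ℤ) j : ℝ)) :
                  EuclideanSpace ℝ (Fin 2))‖ ^ 2)))) +
          ae₂ i * (4 * (β * (L : ℝ) ^ 2) / Λ)) ≤
      (1 / (β * (L : ℝ) ^ 2)) ^ 2 * (4 * (β * (L : ℝ) ^ 2) / Λ) * (4 / (s₁ * L)) ^ 2)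
    (hr₂ : (1 / (β * (L : ℝ) ^ 2)) ^ 2 *
        (1 * ((32 * B₂ + 144 * B₁ + 128) * (β * (L : ℝ) ^ 2) / Λ ^ 3 *
              (K₁ * ‖(WithLp.toLp 2 (fun j => 2 * π / L * ((![-v 1, v 0] : Fin 2 → ℤ) j : ℝ)) : EuclideanSpace ℝ (Fin 2))‖ +
                4 * (K₂ * ‖(WithLp.toLp 2 (fun j => 2 * π / L * ((![-v 1, v 0] : Fin 2 → ℤ) j : ℝ)) : EuclideanSpace ℝ (Fin 2))‖ ^ 2)) ^ 2 +
            (16 * B₁ + 16) * (β * (L : ℝ) ^ 2) / Λ ^ 2 *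
              (K₂ * ‖(WithLp.toLp 2 (fun j => 2 * π / L * ((![-v 1, v 0] : Fin 2 → ℤ) j : ℝ)) : EuclideanSpace ℝ (Fin 2))‖ ^ 2)) +
          2 * (an₁ * ((16 * B₁ + 16) * (β * (L : ℝ) ^ 2) / Λ ^ 2 *
              (K₁ * ‖(WithLp.toLp 2 (fun j => 2 * π / L * ((![-v 1, v 0] : Fin 2 → ℤ) j : ℝ)) : EuclideanSpace ℝ (Fin 2))‖ +
                3 * (K₂ * ‖(WithLp.toLp 2 (fun j => 2 * π / L * ((![-v 1, v 0] : Fin 2 → ℤ) j : ℝ)) : EuclideanSpace ℝ (Fin 2))‖ ^ 2)))) +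
          an₂ * (4 * (β * (L : ℝ) ^ 2) / Λ)) ≤
      (1 / (β * (L : ℝ) ^ 2)) ^ 2 * (4 * (β * (L : ℝ) ^ 2) / Λ) * (4 / (s₂ * L)) ^ 2)
    (hr₃ : (1 / (β * (L : ℝ) ^ 2)) ^ 2 *
        (1 * ((32 * B₂ + 144 * B₁ + 128) * (β * (L : ℝ) ^ 2) / Λ ^ 3 *
              (τ + 4 * (K₂ * ‖(WithLp.toLp 2 (fun j => 2 * π / L * (v j : ℝ)) : EuclideanSpace ℝ (Fin 2))‖ ^ 2)) ^ 2 +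
            (16 * B₁ + 16) * (β * (L : ℝ) ^ 2) / Λ ^ 2 *
              (K₂ * ‖(WithLp.toLp 2 (fun j => 2 * π / L * (v j : ℝ)) : EuclideanSpace ℝ (Fin 2))‖ ^ 2)) +
          2 * (av₁ * ((16 * B₁ + 16) * (β * (L : ℝ) ^ 2) / Λ ^ 2 *
              (τ + 3 * (K₂ * ‖(WithLp.toLp 2 (fun j => 2 * π / L * (v j : ℝ)) : EuclideanSpace ℝ (Fin 2))‖ ^ 2)))) +
          av₂ * (4 * (β * (L : ℝ) ^ 2) / Λ)) ≤
      (1 / (β * (L : ℝ) ^ 2)) ^ 2 * (4 * (β * (L : ℝ) ^ 2) / Λ) * (4 / (s₃ * L)) ^ 2) :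
    ∑ z : TorusSite 1 (2 * M) × TorusSite 2 L,
        ‖∑ q : TorusSite 1 (2 * M) × TorusSite 2 L, (torusChar q.1 z.1 * torusChar q.2 z.2) •
          ((((1 / (β * (L : ℝ) ^ 2) : ℝ) : ℂ) ^ 2 *
            (Mf q * sliceSymbolFnXi (β * (L : ℝ) ^ 2) 0 Λ Λ' (matsubaraFreq β M ⟨(q.1 0).val, ZMod.val_lt (q.1 0)⟩)
              (nambuXiCT L μ K q.2))))‖ ≤
      Real.sqrt (2048 * (1 / s₀ + 1) *
          (4 * ((2 * Real.sqrt 2 / (s₂ * Real.sqrt ((v 0 : ℝ) ^ 2 + (v 1 : ℝ) ^ 2)) + 2) *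
              (2 * Real.sqrt 2 / (s₃ * Real.sqrt ((v 0 : ℝ) ^ 2 + (v 1 : ℝ) ^ 2)) + 2))
            + 16 * (1 / s₁ + 1) ^ 2 / (1 + s₁ * R₀))) *
        Real.sqrt (16 * (2 * M : ℕ) * (L : ℝ) ^ 2 * Ns) * ((1 / (β * (L : ℝ) ^ 2)) ^ 2 * (4 * (β * (L : ℝ) ^ 2) / Λ)) := by
  classical
  -- abbreviations
  set c : ℝ := β * (L : ℝ) ^ 2 with hc_def
  have hc : 0 ≤ c := by positivity
  set c₀ : ℂ := (((1 / (β * (L : ℝ) ^ 2) : ℝ) : ℂ)) ^ 2 with hc₀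
  have hc₀n : ‖c₀‖ = (1 / (β * (L : ℝ) ^ 2)) ^ 2 := by
    rw [hc₀, norm_pow, Complex.norm_real, Real.norm_eq_abs, abs_of_nonneg (by positivity)]
  set Ψ : TorusSite 1 (2 * M) × TorusSite 2 L → ℂ := fun q =>
    sliceSymbolFnXi (β * (L : ℝ) ^ 2) 0 Λ Λ' (matsubaraFreq β M ⟨(q.1 0).val, ZMod.val_lt (q.1 0)⟩) (nambuXiCT L μ K q.2) with hΨ
  have hB10 : 0 ≤ B₁ := (abs_nonneg _).trans (hB₁ 0)
  have hB20 : 0 ≤ B₂ := (abs_nonneg _).trans (hB₂ 0)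
  have hK10 : 0 ≤ K₁ := le_trans (norm_nonneg _) (hK₁ 0)
  have hK20 : 0 ≤ K₂ := le_trans (norm_nonneg _) (hK₂ 0)
  -- propagator data: sup (everywhere)
  have hΨ0 : ∀ q, ‖Ψ q‖ ≤ 4 * c / Λ := fun q => norm_sliceSymbolTorus_le (K := K) (β := β) (μ := μ) hΛ hΛΛ' hc q
  have hb0 : 0 ≤ 4 * c / Λ := by positivity
  -- the sup of `G`
  have hsup : ∀ q, ‖c₀ * (Mf q * Ψ q)‖ ≤ ‖c₀‖ * (4 * c / Λ) := by
    intro q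
    have h := norm_smul_mul_le_of_support c₀ Mf Ψ zero_le_one hb0 hM0 (fun x _ => hΨ0 x) q
    simpa only [one_mul] using h
  have hA₀ : 0 ≤ ‖c₀‖ * (4 * c / Λ) := by positivity
  -- time direction
  have htime : ∀ q, ‖(fwdDiff ((fun _ : Fin 1 => (1 : ZMod (2 * M))), (0 : TorusSite 2 L)))^[2] (fun y => c₀ * (Mf y * Ψ y)) q‖ ≤
      ‖c₀‖ * (1 * ((2 * π / β) ^ 2 * ((32 * B₂ + 144 * B₁ + 128) * c / Λ ^ 3)) +
        2 * (at₁ * ((2 * π / β) * ((16 * B₁ + 16) * c / Λ ^ 2))) + at₂ * (4 * c / Λ)) := by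
    intro q
    exact norm_fwdDiff_iter_two_smul_mul_le_of_support _ c₀ Mf Ψ zero_le_one hat₁ hat₂ hb0 (by positivity) (by positivity)
      hM0 hMt₁ hMt₂ (fun x _ => hΨ0 x)
      (fun x _ => norm_fwdDiff_time_sliceSymbolTorus_le (K := K) (μ := μ) hβ hΛ hΛΛ' hM hc hB₁ x)
      (fun x _ => norm_fwdDiff_two_time_sliceSymbolTorus_le (K := K) (μ := μ) hβ hΛ hΛΛ' hM hc hB₁ hB₂ x) q
  -- generic space direction with tangential datum `τ'` on the support
  have hspace : ∀ (r : Fin 2 → ℤ) (τ' a₁ a₂ : ℝ), 0 ≤ τ' → 0 ≤ a₁ → 0 ≤ a₂ →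
      (∀ q, ‖fwdDiff ((0 : TorusSite 1 (2 * M)), (fun j => ((r j : ℤ) : ZMod L))) Mf q‖ ≤ a₁) →
      (∀ q, ‖(fwdDiff ((0 : TorusSite 1 (2 * M)), (fun j => ((r j : ℤ) : ZMod L))))^[2] Mf q‖ ≤ a₂) →
      (∀ q, Mf q ≠ 0 → |fderiv ℝ (frameLevel μ K) (WithLp.toLp 2 (torusCentredMomentum L q.2))
        (WithLp.toLp 2 (fun i => 2 * π / L * (r i : ℝ)))| ≤ τ') →
      ∀ q, ‖(fwdDiff ((0 : TorusSite 1 (2 * M)), (fun j => ((r j : ℤ) : ZMod L))))^[2] (fun y => c₀ * (Mf y * Ψ y)) q‖ ≤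
        ‖c₀‖ * (1 * ((32 * B₂ + 144 * B₁ + 128) * c / Λ ^ 3 *
              (τ' + 4 * (K₂ * ‖(WithLp.toLp 2 (fun j => 2 * π / L * (r j : ℝ)) : EuclideanSpace ℝ (Fin 2))‖ ^ 2)) ^ 2 +
            (16 * B₁ + 16) * c / Λ ^ 2 * (K₂ * ‖(WithLp.toLp 2 (fun j => 2 * π / L * (r j : ℝ)) : EuclideanSpace ℝ (Fin 2))‖ ^ 2)) +
          2 * (a₁ * ((16 * B₁ + 16) * c / Λ ^ 2 *
              (τ' + 3 * (K₂ * ‖(WithLp.toLp 2 (fun j => 2 * π / L * (r j : ℝ)) : EuclideanSpace ℝ (Fin 2))‖ ^ 2)))) +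
          a₂ * (4 * c / Λ)) := by
    intro r τ' a₁ a₂ hτ' ha₁ ha₂ hM1 hM2 hτr q
    exact norm_fwdDiff_iter_two_smul_mul_le_of_support _ c₀ Mf Ψ zero_le_one ha₁ ha₂ hb0 (by positivity) (by positivity)
      hM0 hM1 hM2 (fun x _ => hΨ0 x)
      (fun x hx => norm_fwdDiff_space_sliceSymbolTorus_le_of_near_support (β := β) hK₂ hΛ hΛΛ' hc hB₁ Mf r hτr x hx)
      (fun x hx => norm_fwdDiff_two_space_sliceSymbolTorus_le_of_near_support (β := β) hK₂ hΛ hΛΛ' hc hB₁ hB₂ Mf r hτr x hx) q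
  -- the isotropic tangential datum for `e₁, e₂, v⊥`
  have htriv : ∀ (r : Fin 2 → ℤ) (q : TorusSite 1 (2 * M) × TorusSite 2 L), Mf q ≠ 0 →
      |fderiv ℝ (frameLevel μ K) (WithLp.toLp 2 (torusCentredMomentum L q.2)) (WithLp.toLp 2 (fun i => 2 * π / L * (r i : ℝ)))| ≤
        K₁ * ‖(WithLp.toLp 2 (fun j => 2 * π / L * (r j : ℝ)) : EuclideanSpace ℝ (Fin 2))‖ :=
    fun r q _ => abs_fderiv_apply_le_of_norm_le hK₁ _ _
  -- `Pi.single i 1` as the reduction of the integer vector `Pi.single i 1`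
  have hsingle : ∀ i : Fin 2, (Pi.single i (1 : ZMod L) : TorusSite 2 L) = fun j => (((Pi.single i (1 : ℤ) : Fin 2 → ℤ) j : ℤ) : ZMod L) := by
    intro i; funext j
    by_cases h : j = i
    · subst h; simp
    · simp [h]
  -- assemble via the master lemma
  have hA : ‖c₀‖ * (4 * c / Λ) = (1 / c) ^ 2 * (4 * c / Λ) := by rw [hc₀n]
  rw [← hA]
  refine sliceCharSum_l1_le_of_data c₀ Mf Ψ v hv hs₀ hs₁ hs₂ hs₃ hR₀ hA₀ hsupp hsup ?_ ?_ ?_ ?_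
  · intro q
    refine (htime q).trans ?_
    rw [hc₀n]; exact hr₀
  · intro q i
    rw [hsingle i]
    refine (hspace (Pi.single i (1 : ℤ)) _ (ae₁ i) (ae₂ i) (by positivity) (hae₁ i) (hae₂ i)
      (fun q => by rw [← hsingle i]; exact hMe₁ q i) (fun q => by rw [← hsingle i]; exact hMe₂ q i) (htriv _) q).trans ?_
    rw [hc₀n]; exact hr₁ i
  · intro q
    refine (hspace (![-v 1, v 0]) _ an₁ an₂ (by positivity) han₁ han₂ hMn₁ hMn₂ (htriv _) q).trans ?_
    rw [hc₀n]; exact hr₂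
  · intro q
    refine (hspace v τ av₁ av₂ hτ0 hav₁ hav₂ hMv₁ hMv₂ hτ q).trans ?_
    rw [hc₀n]; exact hr₃

end Pair

end Summit.HubbardSuperconductivity.HubbardSuperconductivity.Theorems.TorusFourierL2

end
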